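import Summits.QuantumFields.BalabanUV.Beta.MultiscalePartitionCubes
import Summits.QuantumFields.BalabanUV.Beta.MultiscaleParametrixBoxes
import Summits.QuantumFields.BalabanUV.Beta.MultiscalePartitionSecondDiff
import Summits.QuantumFields.BalabanUV.Beta.MultiscaleDecayBudget

/-!
# Beta / MultiscaleCubesFamily — NODE (w4-a′), ROUTE C, THE MULTI-LAYER FAMILY: the layer-indexed thickened squares normalised by
# `puNorm` form an EXACT scale-adapted partition of unity with LEVEL-FREE first and second differences (MODEL; torus `UT N`)

Data: the levels `J` with sides `S_j ≥ 1`, a multiplier `M ≥ 1` with `M·S_j ∣ N_i`, `2M·S_j ≤ N_i`, and a LAYER PREDICATE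
`inLayer j z` on the cubes `z : Ctr N (M·S_j)` of each layer's grid (which cubes of the `M S_j`-grid belong to the layer `Λ_j`).
Construction: `rawFam ⟨j, z⟩ := thickSq^{(M S_j)} z` if `inLayer j z`, else `0` (`MultiscalePartitionCubes`); `cubeFam := puNorm rawFam`
(`MultiscalePartitionNormalize`).  Hypotheses (all (2.1)–(2.2)-SHAPE geometry, DATA): (C0) the layer cubes COVER: every `x` lies in a
cube `z` of some layer with `inLayer j z` — whence the FLOOR `Σ rawFam(x)² ≥ 1` for free (`thickSq ≡ 1` on its cube); (C1) boxes active
at points within distance `2` have comparable scales `S_j ≤ L·S_{j′}`; (C2) at most `n_adj` layers have an active box at any point.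
Results: **`cubeFam_sum_sq`** (`Σ h² = 1` EXACTLY), `abs_cubeFam_le_one`, `cubeFam_eq_zero` (supports), `card_active_le` (at most
`n_adj·(2d + 7)^d` boxes active at a point, `Finset.card_sigma` + `card_thickSq_ne_zero_le`), **`abs_cubeFam_sub_le`**
(`|h_{(j,z)}(x + e_μ) − h_{(j,z)}(x)| ≤ K₁/(M S_j)`, `K₁ = 7^d·8d·(1 + √k·L)`, `k = 2n_adj(2d + 7)^d`) and **`abs_cubeFam_secondDiff_le`**
(`≤ K₂/(M S_j)²` explicit) by gen-8/gen-9's `abs_puNorm_sub_le` / `abs_puNorm_secondDiff_le` with `m₀ = 1` — the scale-adapted bump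
data of `MultiscaleParametrixTorus.parametrix_torus_adapted` for print's own cube-indexed family ([B6] (2.36) SHAPE), LEVEL-FREE.
The hulls / oscillation / assembly (mirroring `MultiscaleParametrixBoxes` §3–§5) are the successor's one remaining module of (w4-a′)
(unit `b2b-balaban-beta-d4-p2`, GEN 9, MODEL crew; O.2 skeleton v1.5.1 §8.10 (K″) ROUTE C).

HONEST FRAMING: discharging `BetaPertH` makes Bałaban's UV stability UNCONDITIONAL — NOT the continuum limit, NOT the
Clay problem.  HONEST DEPENDENCY (verbatim): «continuum YM on T⁴ ⇐ BetaPertH ∧ nine spine estimates (0/9 proved);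
BetaPertH ⇐ (D1) ∧ (D4) ∧ CAP+tail; G-an2-4 gates asym, D1 and NE2/3/4.»  THIS MODULE DISCHARGES NOTHING of `BetaPertH`,
asserts NOTHING printed and cites nothing as a fact (ABSOLUTE RULE): [folklore] bookkeeping; the layer predicate and (C0)–(C2) are
DATA.  LOCI (shape only): [B5] = `Balaban1984PropagatorsI` (1.118) p. 37; [B6] = `Balaban1984PropagatorsII` (2.1)–(2.2) p. 224, (2.36)
p. 229.  No class change on row D4 (critical-path width 0; D4 DISCHARGE NO DATE); NOT BetaPertH, NOT continuum, NOT Clay.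
-/

namespace Summit.QuantumFields.BalabanUV.Beta.MultiscaleCubesFamily

open Finset
open Summit.QuantumFields.BalabanUV.Beta.MultiscalePartitionNormalize
open Summit.QuantumFields.BalabanUV.Beta.MultiscalePartitionSecondDiff
open Summit.QuantumFields.BalabanUV.Beta.MultiscalePartitionCubes
open Literature.MathematicalPhysics.QuantumFieldTheory.Balaban1983to89
open Literature.MathematicalPhysics.QuantumFieldTheory.Balaban1983to89.B9Thm37GlueTorusCov (tblk)
open B5TorusCover (UT Ctr ctrU)
open B5Leibniz121 (up dn up_dn dist_up_le)
open Summit.QuantumFields.BalabanUV.Beta.MultiscaleParametrixBoxes (one_le_MS)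

noncomputable section

variable {d : ℕ} {N : Fin d → ℕ} [∀ i, NeZero (N i)] {J : Type} [Fintype J] (S : J → ℕ) (hS : ∀ l, 1 ≤ S l)
  (M : ℕ) (hM : 1 ≤ M) (hMdiv : ∀ j i, M * S j ∣ N i)

/-! ## §1 The raw family and its normalisation -/

open Classical in
/-- MODEL: **the raw (un-normalised) cube family** — the thickened square of the cube `z` of layer `j`'s grid when `z` belongs to the
layer, `0` otherwise. [cite: Balaban1984PropagatorsII, (2.36) p.229] -/
def rawFam (inLayer : (j : J) → Ctr N (M * S j) → Prop) (p : Σ j : J, Ctr N (M * S j)) (x : UT N) : ℝ :=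
  if inLayer p.1 p.2 then thickSq (one_le_MS S hS hM p.1) (hMdiv p.1) p.2 x else 0

/-- MODEL: **the cube-indexed scale-adapted partition of unity** `h := puNorm rawFam` ([B5] (1.118) / [B6] (2.36) SHAPE).
[cite: Balaban1984PropagatorsI, (1.118) p.37; Balaban1984PropagatorsII, (2.36) p.229] -/
def cubeFam (inLayer : (j : J) → Ctr N (M * S j) → Prop) : (Σ j : J, Ctr N (M * S j)) → UT N → ℝ :=
  puNorm (rawFam S hS M hM hMdiv inLayer)

variable (inLayer : (j : J) → Ctr N (M * S j) → Prop)

omit [Fintype J] in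
/-- `0 ≤ rawFam ≤ 1`. [folklore] -/
theorem rawFam_mem (h2N : ∀ j i, 2 * (M * S j) ≤ N i) (p : Σ j : J, Ctr N (M * S j)) (x : UT N) :
    0 ≤ rawFam S hS M hM hMdiv inLayer p x ∧ rawFam S hS M hM hMdiv inLayer p x ≤ 1 := by
  classical
  unfold rawFam
  split_ifs
  · exact ⟨thickSq_nonneg _ _ _ _, thickSq_le_one _ _ (h2N p.1) _ _⟩
  · exact ⟨le_rfl, zero_le_one⟩

/-- **(C0) ⟹ THE FLOOR**: if `x` lies in a layer cube then `Σ_p rawFam_p(x)² ≥ 1` (that cube's thickened square is `1` at `x`).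
[folklore] -/
theorem one_le_sqSum (h2N : ∀ j i, 2 * (M * S j) ≤ N i) {x : UT N} {j : J}
    (hx : inLayer j (tblk (one_le_MS S hS hM j) (hMdiv j) x)) : 1 ≤ sqSum (rawFam S hS M hM hMdiv inLayer) x := by
  classical
  unfold sqSum
  have h1 : rawFam S hS M hM hMdiv inLayer ⟨j, tblk (one_le_MS S hS hM j) (hMdiv j) x⟩ x = 1 := by
    unfold rawFam
    rw [if_pos hx]
    exact thickSq_eq_one_of_tblk _ _ (h2N j) rfl
  calc (1 : ℝ) = rawFam S hS M hM hMdiv inLayer ⟨j, tblk (one_le_MS S hS hM j) (hMdiv j) x⟩ x ^ 2 := by rw [h1]; norm_num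
    _ ≤ ∑ p, rawFam S hS M hM hMdiv inLayer p x ^ 2 :=
        Finset.single_le_sum (f := fun p => rawFam S hS M hM hMdiv inLayer p x ^ 2) (fun _ _ => sq_nonneg _) (mem_univ _)

/-- **EXACT PARTITION OF UNITY**: under (C0), `Σ_p h_p(x)² = 1`. [cite: Balaban1984PropagatorsI, (1.118) p.37] -/
theorem cubeFam_sum_sq (h2N : ∀ j i, 2 * (M * S j) ≤ N i)
    (hcov : ∀ x, ∃ j, inLayer j (tblk (one_le_MS S hS hM j) (hMdiv j) x)) (x : UT N) :
    ∑ p, cubeFam S hS M hM hMdiv inLayer p x ^ 2 = 1 := by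
  obtain ⟨j, hj⟩ := hcov x
  exact sum_sq_puNorm (lt_of_lt_of_le zero_lt_one (one_le_sqSum S hS M hM hMdiv inLayer h2N hj))

/-- `|h_p| ≤ 1`. [folklore] -/
theorem abs_cubeFam_le_one (p : Σ j : J, Ctr N (M * S j)) (x : UT N) : |cubeFam S hS M hM hMdiv inLayer p x| ≤ 1 :=
  abs_puNorm_le_one _ p x

/-- Supports: `rawFam_p(x) = 0 ⟹ h_p(x) = 0`. [folklore] -/
theorem cubeFam_eq_zero {p : Σ j : J, Ctr N (M * S j)} {x : UT N} (h : rawFam S hS M hM hMdiv inLayer p x = 0) :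
    cubeFam S hS M hM hMdiv inLayer p x = 0 := puNorm_eq_zero h

omit [Fintype J] in
/-- `rawFam_{(j,z)}(x) ≠ 0 ⟹ inLayer j z ∧ thickSq z x ≠ 0`. [folklore] -/
theorem rawFam_ne_zero {p : Σ j : J, Ctr N (M * S j)} {x : UT N} (h : rawFam S hS M hM hMdiv inLayer p x ≠ 0) :
    inLayer p.1 p.2 ∧ thickSq (one_le_MS S hS hM p.1) (hMdiv p.1) p.2 x ≠ 0 := by
  classical
  unfold rawFam at h
  split_ifs at h with hin
  · exact ⟨hin, h⟩
  · exact absurd rfl h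

/-! ## §2 The active count -/

/-- **At most `n_adj·(2d + 7)^d` boxes are active at a point** under (C2) «at most `n_adj` layers have an active box at `x`»
(`Finset.card_sigma` + `card_thickSq_ne_zero_le`). [folklore] -/
theorem card_active_le [NeZero d] [DecidableEq J] {nadj : ℕ}
    (hlay : ∀ x, (univ.filter fun j : J => ∃ z : Ctr N (M * S j), rawFam S hS M hM hMdiv inLayer ⟨j, z⟩ x ≠ 0).card ≤ nadj)
    (x : UT N) :
    (univ.filter fun p : Σ j : J, Ctr N (M * S j) => rawFam S hS M hM hMdiv inLayer p x ≠ 0).card ≤ nadj * (2 * d + 7) ^ d := by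
  classical
  let A : (j : J) → Finset (Ctr N (M * S j)) := fun j => univ.filter fun z : Ctr N (M * S j) => rawFam S hS M hM hMdiv inLayer ⟨j, z⟩ x ≠ 0
  set Jx := univ.filter fun j : J => ∃ z : Ctr N (M * S j), rawFam S hS M hM hMdiv inLayer ⟨j, z⟩ x ≠ 0 with hJx
  have hsub : (univ.filter fun p : Σ j : J, Ctr N (M * S j) => rawFam S hS M hM hMdiv inLayer p x ≠ 0) ⊆ Jx.sigma A := by
    intro p hp
    rw [mem_filter] at hp
    rw [Finset.mem_sigma, hJx, mem_filter]
    exact ⟨⟨mem_univ _, ⟨p.2, hp.2⟩⟩, by simp only [A, mem_filter]; exact ⟨mem_univ _, hp.2⟩⟩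
  have hAj : ∀ j, (A j).card ≤ (2 * d + 7) ^ d := by
    intro j
    have h1 : A j ⊆ univ.filter fun z : Ctr N (M * S j) => thickSq (one_le_MS S hS hM j) (hMdiv j) z x ≠ 0 := by
      intro z hz
      simp only [A, mem_filter] at hz
      rw [mem_filter]
      exact ⟨mem_univ _, (rawFam_ne_zero S hS M hM hMdiv inLayer hz.2).2⟩
    have h2 := card_thickSq_ne_zero_le (one_le_MS S hS hM j) (hMdiv j) x
    have h3 : (((univ.filter fun z : Ctr N (M * S j) => thickSq (one_le_MS S hS hM j) (hMdiv j) z x ≠ 0).card : ℕ) : ℝ) ≤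
        ((2 * d + 7) ^ d : ℕ) := by
      have e : (2 * (d + 2 : ℝ) + 3) ^ d = (((2 * d + 7) ^ d : ℕ) : ℝ) := by push_cast; ring
      rw [← e]; exact h2
    exact (Finset.card_le_card h1).trans (by exact_mod_cast h3)
  calc (univ.filter fun p : Σ j : J, Ctr N (M * S j) => rawFam S hS M hM hMdiv inLayer p x ≠ 0).card
      ≤ (Jx.sigma A).card := Finset.card_le_card hsub
    _ = ∑ j ∈ Jx, (A j).card := Finset.card_sigma _ _
    _ ≤ ∑ _j ∈ Jx, (2 * d + 7) ^ d := Finset.sum_le_sum fun j _ => hAj j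
    _ = Jx.card * (2 * d + 7) ^ d := by rw [Finset.sum_const, smul_eq_mul]
    _ ≤ nadj * (2 * d + 7) ^ d := Nat.mul_le_mul_right _ (hlay x)

/-! ## §3 First and second differences of the normalised family -/

omit [Fintype J] in
/-- Raw increments across a bond: `≤ 7^d·8d/(M S_j)`. [folklore] -/
theorem abs_rawFam_sub_le (p : Σ j : J, Ctr N (M * S j)) (x : UT N) (μ : Fin d) :
    |rawFam S hS M hM hMdiv inLayer p (up x μ) - rawFam S hS M hM hMdiv inLayer p x| ≤ 7 ^ d * (8 * d / ((M : ℝ) * S p.1)) := by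
  classical
  unfold rawFam
  have hMS : ((M * S p.1 : ℕ) : ℝ) = (M : ℝ) * S p.1 := by push_cast; ring
  split_ifs
  · have h := abs_thickSq_sub_le (one_le_MS S hS hM p.1) (hMdiv p.1) p.2 x μ
    rwa [hMS] at h
  · rw [sub_self, abs_zero]; positivity

omit [Fintype J] in
/-- Raw centred second differences: `≤ 7^d·(32d² + 104)/(M S_j)²`. [folklore] -/
theorem abs_rawFam_secondDiff_le (h2N : ∀ j i, 2 * (M * S j) ≤ N i) (p : Σ j : J, Ctr N (M * S j)) (x : UT N) (μ : Fin d) :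
    |rawFam S hS M hM hMdiv inLayer p (up x μ) - 2 * rawFam S hS M hM hMdiv inLayer p x + rawFam S hS M hM hMdiv inLayer p (dn x μ)| ≤
      7 ^ d * ((32 * d ^ 2 + 104) / ((M : ℝ) * S p.1) ^ 2) := by
  classical
  unfold rawFam
  have hMS : ((M * S p.1 : ℕ) : ℝ) = (M : ℝ) * S p.1 := by push_cast; ring
  split_ifs
  · have h := abs_thickSq_secondDiff_le (one_le_MS S hS hM p.1) (hMdiv p.1) (h2N p.1) p.2 x μ
    rwa [hMS] at h
  · norm_num; positivity

omit [Fintype J] in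
/-- Comparable scales give comparable raw increments: `S_j ≤ L·S_{j′}` ⟹ `7^d·8d/(M S_{j′}) ≤ 7^d·8d·L/(M S_j)` (and the same for the
second-difference constant with `L²`). [folklore] -/
theorem scaled_le (hS₁ : ∀ l, 1 ≤ S l) (hM₁ : 1 ≤ M) {A : ℝ} (hA : 0 ≤ A) {L : ℕ} {j j' : J} (hcmp : S j ≤ L * S j') (n : ℕ) :
    A / ((M : ℝ) * S j') ^ n ≤ A * (L : ℝ) ^ n / ((M : ℝ) * S j) ^ n := by
  have hM0 : (0 : ℝ) < M := by exact_mod_cast hM₁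
  have hSj : (0 : ℝ) < S j := by exact_mod_cast hS₁ j
  have hSj' : (0 : ℝ) < S j' := by exact_mod_cast hS₁ j'
  have hcmp' : (S j : ℝ) ≤ L * S j' := by exact_mod_cast hcmp
  have hL0 : (0 : ℝ) < L := by
    rcases Nat.eq_zero_or_pos L with h | h
    · rw [h] at hcmp; have := hS₁ j; omega
    · exact_mod_cast h
  rw [div_le_div_iff₀ (by positivity) (by positivity)]
  have key : ((M : ℝ) * S j) ^ n ≤ ((M : ℝ) * S j' * L) ^ n :=
    pow_le_pow_left₀ (by positivity) (by nlinarith) n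
  calc A * ((M : ℝ) * S j) ^ n ≤ A * ((M : ℝ) * S j' * L) ^ n := mul_le_mul_of_nonneg_left key hA
    _ = A * (L : ℝ) ^ n * ((M : ℝ) * S j') ^ n := by rw [mul_pow]; ring

/-- **FIRST DIFFERENCES OF THE CUBE FAMILY (MODEL; level-free).**  Under (C0) (floor), (C1) «boxes active at points within distance
`2` have scales within a factor `L`» and (C2) «≤ n_adj layers active at a point»:
`|h_{(j,z)}(x + e_μ) − h_{(j,z)}(x)| ≤ 7^d·8d·(1 + √(2n_adj(2d+7)^d)·L)/(M S_j)`. [cite: Balaban1984PropagatorsII, (2.36) p.229] -/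
theorem abs_cubeFam_sub_le [NeZero d] [DecidableEq J] (h2N : ∀ j i, 2 * (M * S j) ≤ N i)
    (hcov : ∀ x, ∃ j, inLayer j (tblk (one_le_MS S hS hM j) (hMdiv j) x)) {L : ℕ}
    (hcmp : ∀ (p q : Σ j : J, Ctr N (M * S j)) (x y : UT N), dist x y ≤ 2 →
      rawFam S hS M hM hMdiv inLayer p x ≠ 0 → rawFam S hS M hM hMdiv inLayer q y ≠ 0 → S p.1 ≤ L * S q.1) {nadj : ℕ}
    (hlay : ∀ x, (univ.filter fun j : J => ∃ z : Ctr N (M * S j), rawFam S hS M hM hMdiv inLayer ⟨j, z⟩ x ≠ 0).card ≤ nadj)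
    (p : Σ j : J, Ctr N (M * S j)) (x : UT N) (μ : Fin d) :
    |cubeFam S hS M hM hMdiv inLayer p (up x μ) - cubeFam S hS M hM hMdiv inLayer p x| ≤
      7 ^ d * (8 * d) / ((M : ℝ) * S p.1) + Real.sqrt ((2 * nadj * (2 * d + 7) ^ d : ℕ)) * (7 ^ d * (8 * d) * L / ((M : ℝ) * S p.1)) := by
  classical
  set ht := rawFam S hS M hM hMdiv inLayer with hht
  have hM0 : (0 : ℝ) < M := by exact_mod_cast hM
  have hSp : (0 : ℝ) < S p.1 := by exact_mod_cast hS p.1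
  have hK0 : 0 ≤ 7 ^ d * (8 * d) / ((M : ℝ) * S p.1) +
      Real.sqrt ((2 * nadj * (2 * d + 7) ^ d : ℕ)) * (7 ^ d * (8 * d) * L / ((M : ℝ) * S p.1)) := by positivity
  -- trivial case: p inactive at both points
  by_cases hact : ht p (up x μ) ≠ 0 ∨ ht p x ≠ 0
  swap
  · push Not at hact
    rw [cubeFam, ← hht, puNorm_eq_zero hact.1, puNorm_eq_zero hact.2, sub_self, abs_zero]
    exact hK0
  -- floors
  obtain ⟨j1, hj1⟩ := hcov (up x μ)
  obtain ⟨j2, hj2⟩ := hcov x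
  have hfx' := one_le_sqSum S hS M hM hMdiv inLayer h2N hj1
  have hfx := one_le_sqSum S hS M hM hMdiv inLayer h2N hj2
  -- the active count at the two points
  have hk : (univ.filter fun w : Σ j : J, Ctr N (M * S j) => ht w (up x μ) ≠ 0 ∨ ht w x ≠ 0).card ≤ 2 * nadj * (2 * d + 7) ^ d := by
    have hu : (univ.filter fun w : Σ j : J, Ctr N (M * S j) => ht w (up x μ) ≠ 0 ∨ ht w x ≠ 0) ⊆
        (univ.filter fun w : Σ j : J, Ctr N (M * S j) => ht w (up x μ) ≠ 0) ∪
          (univ.filter fun w : Σ j : J, Ctr N (M * S j) => ht w x ≠ 0) := by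
      intro w hw; rw [mem_filter] at hw
      rcases hw.2 with h | h
      · apply Finset.mem_union_left; exact Finset.mem_filter.mpr ⟨mem_univ w, h⟩
      · apply Finset.mem_union_right; exact Finset.mem_filter.mpr ⟨mem_univ w, h⟩
    refine (Finset.card_le_card hu).trans ((Finset.card_union_le _ _).trans ?_)
    have h1 := card_active_le S hS M hM hMdiv inLayer hlay (up x μ)
    have h2 := card_active_le S hS M hM hMdiv inLayer hlay x
    rw [← hht] at h1 h2
    calc _ ≤ nadj * (2 * d + 7) ^ d + nadj * (2 * d + 7) ^ d := Nat.add_le_add h1 h2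
      _ = 2 * nadj * (2 * d + 7) ^ d := by ring
  -- uniform increment bound over the active indices (gbar := 7^d·8d·L/(M S_j))
  have hdist : dist (up x μ) x ≤ 2 := by
    rw [dist_comm]; exact (dist_up_le x μ).trans (by norm_num)
  have hg : ∀ w : Σ j : J, Ctr N (M * S j), (ht w (up x μ) ≠ 0 ∨ ht w x ≠ 0) →
      |ht w (up x μ) - ht w x| ≤ 7 ^ d * (8 * d) * L / ((M : ℝ) * S p.1) := by
    intro w hw
    have hraw := abs_rawFam_sub_le S hS M hM hMdiv inLayer w x μ
    rw [← hht] at hraw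
    -- S p.1 ≤ L * S w.1 from (C1): p active at up x μ or x, w active at up x μ or x, all pairs within distance ≤ 2
    have hcmp' : S p.1 ≤ L * S w.1 := by
      rcases hact with hp | hp <;> rcases hw with hq | hq
      · exact hcmp p w _ _ (by rw [dist_self]; norm_num) hp hq
      · exact hcmp p w _ _ hdist hp hq
      · exact hcmp p w _ _ (by rw [dist_comm]; exact hdist) hp hq
      · exact hcmp p w _ _ (by rw [dist_self]; norm_num) hp hq
    have hs := scaled_le S M hS hM (show (0 : ℝ) ≤ 7 ^ d * (8 * d) by positivity) hcmp' 1
    simp only [pow_one] at hs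
    calc |ht w (up x μ) - ht w x| ≤ 7 ^ d * (8 * d / ((M : ℝ) * S w.1)) := hraw
      _ = 7 ^ d * (8 * d) / ((M : ℝ) * S w.1) := by ring
      _ ≤ 7 ^ d * (8 * d) * L / ((M : ℝ) * S p.1) := hs
  -- the increment of the index p itself
  have hgp : |ht p (up x μ) - ht p x| ≤ 7 ^ d * (8 * d) / ((M : ℝ) * S p.1) := by
    have h := abs_rawFam_sub_le S hS M hM hMdiv inLayer p x μ
    rw [← hht] at h
    calc |ht p (up x μ) - ht p x| ≤ 7 ^ d * (8 * d / ((M : ℝ) * S p.1)) := h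
      _ = _ := by ring
  have hmain := abs_puNorm_sub_le (ht := ht) zero_lt_one hfx' hfx p hgp hk hg
  rw [cubeFam, ← hht]
  rw [Real.sqrt_one, div_one] at hmain
  exact hmain

/-- **SECOND DIFFERENCES OF THE CUBE FAMILY (MODEL; level-free).**  Under (C0), (C1), (C2) and `2M S_j ≤ N_i`:
`|h_{(j,z)}(x + e_μ) − 2h_{(j,z)}(x) + h_{(j,z)}(x − e_μ)| ≤ ((1 + √k)·7^d(32d² + 104)·L² + (2√k + 4k)·(7^d·8d·L)²)/(M S_j)²`,
`k = 3n_adj(2d + 7)^d`. [cite: Balaban1984PropagatorsII, (2.36) p.229 + (2.40) p.230] -/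
theorem abs_cubeFam_secondDiff_le [NeZero d] [DecidableEq J] (h2N : ∀ j i, 2 * (M * S j) ≤ N i)
    (hcov : ∀ x, ∃ j, inLayer j (tblk (one_le_MS S hS hM j) (hMdiv j) x)) {L : ℕ}
    (hcmp : ∀ (p q : Σ j : J, Ctr N (M * S j)) (x y : UT N), dist x y ≤ 2 →
      rawFam S hS M hM hMdiv inLayer p x ≠ 0 → rawFam S hS M hM hMdiv inLayer q y ≠ 0 → S p.1 ≤ L * S q.1) {nadj : ℕ}
    (hlay : ∀ x, (univ.filter fun j : J => ∃ z : Ctr N (M * S j), rawFam S hS M hM hMdiv inLayer ⟨j, z⟩ x ≠ 0).card ≤ nadj)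
    (p : Σ j : J, Ctr N (M * S j)) (x : UT N) (μ : Fin d) :
    |cubeFam S hS M hM hMdiv inLayer p (up x μ) - 2 * cubeFam S hS M hM hMdiv inLayer p x + cubeFam S hS M hM hMdiv inLayer p (dn x μ)| ≤
      (1 + Real.sqrt ((3 * nadj * (2 * d + 7) ^ d : ℕ))) * (7 ^ d * (32 * d ^ 2 + 104) * (L : ℝ) ^ 2 / ((M : ℝ) * S p.1) ^ 2) +
        (2 * Real.sqrt ((3 * nadj * (2 * d + 7) ^ d : ℕ)) + 4 * ((3 * nadj * (2 * d + 7) ^ d : ℕ) : ℝ)) *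
          (7 ^ d * (8 * d) * L / ((M : ℝ) * S p.1)) ^ 2 := by
  classical
  set ht := rawFam S hS M hM hMdiv inLayer with hht
  set k : ℕ := 3 * nadj * (2 * d + 7) ^ d with hkdef
  have hM0 : (0 : ℝ) < M := by exact_mod_cast hM
  have hSp : (0 : ℝ) < S p.1 := by exact_mod_cast hS p.1
  have hRHS0 : 0 ≤ (1 + Real.sqrt (k : ℕ)) * (7 ^ d * (32 * d ^ 2 + 104) * (L : ℝ) ^ 2 / ((M : ℝ) * S p.1) ^ 2) +
        (2 * Real.sqrt (k : ℕ) + 4 * ((k : ℕ) : ℝ)) * (7 ^ d * (8 * d) * L / ((M : ℝ) * S p.1)) ^ 2 := by positivity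
  -- trivial case: p inactive at all three points
  by_cases hact : ht p (dn x μ) ≠ 0 ∨ ht p x ≠ 0 ∨ ht p (up x μ) ≠ 0
  swap
  · push Not at hact
    rw [cubeFam, ← hht, puNorm_eq_zero hact.1, puNorm_eq_zero hact.2.1, puNorm_eq_zero hact.2.2]
    norm_num
    exact hRHS0
  obtain ⟨j1, hj1⟩ := hcov (dn x μ)
  obtain ⟨j2, hj2⟩ := hcov x
  obtain ⟨j3, hj3⟩ := hcov (up x μ)
  have hf1 := one_le_sqSum S hS M hM hMdiv inLayer h2N hj1
  have hf2 := one_le_sqSum S hS M hM hMdiv inLayer h2N hj2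
  have hf3 := one_le_sqSum S hS M hM hMdiv inLayer h2N hj3
  -- active count at the three points
  have hk : (univ.filter fun w : Σ j : J, Ctr N (M * S j) => ht w (dn x μ) ≠ 0 ∨ ht w x ≠ 0 ∨ ht w (up x μ) ≠ 0).card ≤ k := by
    have hu1 : (univ.filter fun w : Σ j : J, Ctr N (M * S j) => ht w (dn x μ) ≠ 0 ∨ ht w x ≠ 0 ∨ ht w (up x μ) ≠ 0) ⊆
        (univ.filter fun w : Σ j : J, Ctr N (M * S j) => ht w (dn x μ) ≠ 0) ∪
          (univ.filter fun w : Σ j : J, Ctr N (M * S j) => ht w x ≠ 0 ∨ ht w (up x μ) ≠ 0) := by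
      intro w hw; rw [mem_filter] at hw
      rcases hw.2 with h | h
      · apply Finset.mem_union_left; exact Finset.mem_filter.mpr ⟨mem_univ w, h⟩
      · apply Finset.mem_union_right; exact Finset.mem_filter.mpr ⟨mem_univ w, h⟩
    have hu2 : (univ.filter fun w : Σ j : J, Ctr N (M * S j) => ht w x ≠ 0 ∨ ht w (up x μ) ≠ 0) ⊆
        (univ.filter fun w : Σ j : J, Ctr N (M * S j) => ht w x ≠ 0) ∪
          (univ.filter fun w : Σ j : J, Ctr N (M * S j) => ht w (up x μ) ≠ 0) := by
      intro w hw; rw [mem_filter] at hw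
      rcases hw.2 with h | h
      · apply Finset.mem_union_left; exact Finset.mem_filter.mpr ⟨mem_univ w, h⟩
      · apply Finset.mem_union_right; exact Finset.mem_filter.mpr ⟨mem_univ w, h⟩
    have h1 := card_active_le S hS M hM hMdiv inLayer hlay (dn x μ)
    have h2 := card_active_le S hS M hM hMdiv inLayer hlay x
    have h3 := card_active_le S hS M hM hMdiv inLayer hlay (up x μ)
    rw [← hht] at h1 h2 h3
    have c23 := (Finset.card_le_card hu2).trans ((Finset.card_union_le _ _).trans (Nat.add_le_add h2 h3))
    have c123 := (Finset.card_le_card hu1).trans ((Finset.card_union_le _ _).trans (Nat.add_le_add h1 c23))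
    rw [hkdef]
    calc _ ≤ nadj * (2 * d + 7) ^ d + (nadj * (2 * d + 7) ^ d + nadj * (2 * d + 7) ^ d) := c123
      _ = 3 * nadj * (2 * d + 7) ^ d := by ring
  -- distances among the three points are ≤ 2
  have hd_up : dist x (up x μ) ≤ 1 := dist_up_le x μ
  have hd_dn : dist (dn x μ) x ≤ 1 := by have := dist_up_le (dn x μ) μ; rwa [up_dn] at this
  have d11 : dist (dn x μ) (dn x μ) ≤ 2 := by rw [dist_self]; norm_num
  have d22 : dist x x ≤ 2 := by rw [dist_self]; norm_num
  have d33 : dist (up x μ) (up x μ) ≤ 2 := by rw [dist_self]; norm_num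
  have d12 : dist (dn x μ) x ≤ 2 := hd_dn.trans (by norm_num)
  have d21 : dist x (dn x μ) ≤ 2 := by rw [dist_comm]; exact d12
  have d23 : dist x (up x μ) ≤ 2 := hd_up.trans (by norm_num)
  have d32 : dist (up x μ) x ≤ 2 := by rw [dist_comm]; exact d23
  have d13 : dist (dn x μ) (up x μ) ≤ 2 := (dist_triangle _ x _).trans (by linarith)
  have d31 : dist (up x μ) (dn x μ) ≤ 2 := by rw [dist_comm]; exact d13
  -- scale comparison S p.1 ≤ L S w.1 for any w active at one of the three points
  have hcmpw : ∀ w : Σ j : J, Ctr N (M * S j), (ht w (dn x μ) ≠ 0 ∨ ht w x ≠ 0 ∨ ht w (up x μ) ≠ 0) → S p.1 ≤ L * S w.1 := by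
    intro w hw
    rcases hact with hp | hp | hp <;> rcases hw with hq | hq | hq
    · exact hcmp p w _ _ d11 hp hq
    · exact hcmp p w _ _ d12 hp hq
    · exact hcmp p w _ _ d13 hp hq
    · exact hcmp p w _ _ d21 hp hq
    · exact hcmp p w _ _ d22 hp hq
    · exact hcmp p w _ _ d23 hp hq
    · exact hcmp p w _ _ d31 hp hq
    · exact hcmp p w _ _ d32 hp hq
    · exact hcmp p w _ _ d33 hp hq
  -- uniform first and second increments over the active indices
  set g1 : ℝ := 7 ^ d * (8 * d) * L / ((M : ℝ) * S p.1) with hg1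
  set g2 : ℝ := 7 ^ d * (32 * d ^ 2 + 104) * (L : ℝ) ^ 2 / ((M : ℝ) * S p.1) ^ 2 with hg2
  have hg1_0 : 0 ≤ g1 := by positivity
  have hg2_0 : 0 ≤ g2 := by positivity
  have hg : ∀ w : Σ j : J, Ctr N (M * S j), (ht w (dn x μ) ≠ 0 ∨ ht w x ≠ 0 ∨ ht w (up x μ) ≠ 0) →
      |ht w (up x μ) - ht w x| ≤ g1 ∧ |ht w x - ht w (dn x μ)| ≤ g1 := by
    intro w hw
    have hs := scaled_le S M hS hM (show (0 : ℝ) ≤ 7 ^ d * (8 * d) by positivity) (hcmpw w hw) 1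
    simp only [pow_one] at hs
    have e1 : 7 ^ d * (8 * d / ((M : ℝ) * S w.1)) = 7 ^ d * (8 * d) / ((M : ℝ) * S w.1) := by ring
    constructor
    · have h := abs_rawFam_sub_le S hS M hM hMdiv inLayer w x μ
      exact h.trans ((le_of_eq e1).trans hs)
    · have h := abs_rawFam_sub_le S hS M hM hMdiv inLayer w (dn x μ) μ
      rw [up_dn] at h
      exact h.trans ((le_of_eq e1).trans hs)
  have hg₂ : ∀ w : Σ j : J, Ctr N (M * S j), (ht w (dn x μ) ≠ 0 ∨ ht w x ≠ 0 ∨ ht w (up x μ) ≠ 0) →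
      |ht w (up x μ) - 2 * ht w x + ht w (dn x μ)| ≤ g2 := by
    intro w hw
    have hs := scaled_le S M hS hM (show (0 : ℝ) ≤ 7 ^ d * (32 * d ^ 2 + 104) by positivity) (hcmpw w hw) 2
    have h := abs_rawFam_secondDiff_le S hS M hM hMdiv inLayer h2N w x μ
    have e2 : 7 ^ d * ((32 * d ^ 2 + 104) / ((M : ℝ) * S w.1) ^ 2) = 7 ^ d * (32 * d ^ 2 + 104) / ((M : ℝ) * S w.1) ^ 2 := by ring
    exact h.trans ((le_of_eq e2).trans hs)
  have hmain := abs_puNorm_secondDiff_le (ht := ht) zero_lt_one hf1 hf2 hf3 p hk hg1_0 hg2_0 hg hg₂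
  rw [cubeFam, ← hht]
  rw [Real.sqrt_one, div_one, div_one] at hmain
  exact hmain

end

end Summit.QuantumFields.BalabanUV.Beta.MultiscaleCubesFamily
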